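/-
Copyright: statement-level skeleton of a published paper (lit-balaban cell, reader/typer r15). No proof claims beyond
what the kernel checks below.
-/
import Literature.MathematicalPhysics.QuantumFieldTheory.Balaban1983to89.Setup

/-!
# B3 — T. Bałaban, *(Higgs)₂,₃ quantum fields in a finite volume. III. Renormalization*, CMP **88** (1983) 411–445
[Balaban1983Higgs3], Sect. 3 p. 438: the mass-counterterm subtraction identity (3.19) for primitively divergent scalar
self-energy graphs and the chain estimate for the Hölder weight

statement-level skeleton of published theorems with citation tags; proofs where landed; nothing here is a claim about
the Yang–Mills mass gap

Source: held text `paper:balaban1983-higgs-2-3-quantum-fields-finite-volume` (journal page = PDF page + 410); render of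
p. 438 read as an image (`run/shared/lean/pub/pub-balaban/b2b-balaban-ref1/pages/1983-cmp88-higgs23-III/…-p028-x2.png`).
Row **B3.Eq3.18-3.20** of `HOME/lit-balaban-r15/ROWS-B3.md` (reader/typer r15, fold owner of B3); sibling of
`B3Sect3ScalarSelfEnergy` ((3.9), (3.11), (3.16)).  CARRIERS: the torus `Site P j` and site fields `SiteField P j W` OF RECORD
(`…Balaban1983to89.Setup`), `W` a real inner-product space (the paper: ℝ^N); the self-energy kernel Σ(x,x′) with values in
the linear maps of `W` (it carries the internal-index structure, e.g. q² in (3.9)); the distance |x′−x| on the torus as a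
supplied function `dist` (positive off the diagonal).

THE PRINTED TEXT (verbatim, p. 438 [PDF 28]).  *"Let us consider the other cases of self-energy graphs for scalar fields. All
the remaining divergent graphs of this type have degrees equal to 0. Primitively divergent graphs, i.e. the graphs [seven
pictures], (3.18) are treated in a simpler way. If Σ(x,x′) is an expression corresponding to any such graph, then we have a graph
with mass renormalization counterterm of the form −Σ_{x′}η^dΣ(x,x′), and we write
Σ_{x,x′} η^{2d}φ(x)·Σ(x,x′)φ′(x′) − Σ_x η^dφ(x)·(Σ_{x′}η^dΣ(x,x′))φ′(x) = Σ_{x,x′} η^{2d}φ(x)·(Σ(x,x′)|x′−x|^α)(φ′(x′) − φ′(x))/|x′−x|^α.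
(3.19) We get a generalized expression of degree +α represented by some generalized graph whose every subgraph has a positive
degree also. Graphically we write it as follows [picture] (3.20) … For graphs of higher orders usually there is a chain of
propagators connecting a vertex localized in x with a vertex localized in x′, and then we estimate
|x′−x|^α ≤ |x′−x₁|^α + … + |x_l−x|^α."*

WHAT IS PROVED.  **(3.19)** (`eq319`): the graph-minus-counterterm combination equals the Hölder-weighted form, for every
kernel Σ, every α and every `dist` vanishing only on the diagonal (`hpos`); its x′ = x terms vanish on both sides (Lean's
0⁻¹ = 0 makes the printed 0·(0/0) harmless).  The CHAIN ESTIMATE (`rpow_chain_le`): for 0 < α ≤ 1 (the Hölder exponent) and a chain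
x = x₀, x₁, …, x_l, x′ with |x′−x| ≤ Σ_i |x_i − x_{i−1}| (triangle inequality, hypothesis `ht`), |x′−x|^α ≤ Σ_i |x_i − x_{i−1}|^α —
from the subadditivity of t ↦ t^α (Mathlib `Real.rpow_add_le_add_rpow`).  NOT TYPED: the pictures (3.18), (3.20).  NOTHING
beyond the kernel-checked statements below is asserted.
-/

open scoped BigOperators RealInnerProductSpace

namespace Literature.MathematicalPhysics.QuantumFieldTheory.Balaban1983to89.B3Sect3Subtraction319

noncomputable section

section Eq319

variable {P : Params} {j : ℕ} {W : Type*} [NormedAddCommGroup W] [InnerProductSpace ℝ W]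

/-- The left side of **(3.19)** p. 438: a two-scalar-leg expression with kernel Σ(x,x′) minus its mass-renormalization
counterterm *"of the form −Σ_{x′}η^dΣ(x,x′)"*: Σ_{x,x′}η^{2d}φ(x)·Σ(x,x′)φ′(x′) − Σ_xη^dφ(x)·(Σ_{x′}η^dΣ(x,x′))φ′(x).
[cite: Balaban1983Higgs3, (3.19) p.438] -/
def subtracted319 (η : ℝ) (Sg : Site P j → Site P j → W →ₗ[ℝ] W) (φ φ' : SiteField P j W) : ℝ :=
  (∑ x : Site P j, ∑ x' : Site P j, η ^ (2 * P.d) * ⟪φ x, Sg x x' (φ' x')⟫) -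
    ∑ x : Site P j, η ^ P.d * ⟪φ x, (∑ x' : Site P j, η ^ P.d • Sg x x') (φ' x)⟫

/-- The right side of **(3.19)** p. 438: Σ_{x,x′}η^{2d}φ(x)·(Σ(x,x′)|x′−x|^α)(φ′(x′) − φ′(x))/|x′−x|^α — *"a generalized
expression of degree +α"* (the kernel gains the weight |x′−x|^α, the leg the Hölder difference quotient).
[cite: Balaban1983Higgs3, (3.19) p.438] -/
def holderForm319 (η α : ℝ) (dist : Site P j → Site P j → ℝ) (Sg : Site P j → Site P j → W →ₗ[ℝ] W)
    (φ φ' : SiteField P j W) : ℝ :=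
  ∑ x : Site P j, ∑ x' : Site P j,
    η ^ (2 * P.d) * ⟪φ x, (dist x x' ^ α • Sg x x') ((dist x x' ^ α)⁻¹ • (φ' x' - φ' x))⟫

/-- **(3.19)** p. 438 [PDF 28], verbatim: *"Σ_{x,x′} η^{2d}φ(x)·Σ(x,x′)φ′(x′) − Σ_x η^dφ(x)·(Σ_{x′}η^dΣ(x,x′))φ′(x)
= Σ_{x,x′} η^{2d}φ(x)·(Σ(x,x′)|x′−x|^α)(φ′(x′) − φ′(x))/|x′−x|^α. (3.19)"* — PROVED for every kernel Σ (values in the linear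
maps of the internal space), every exponent α and every distance function positive off the diagonal.
[cite: Balaban1983Higgs3, (3.19) p.438] -/
theorem eq319 (η α : ℝ) (dist : Site P j → Site P j → ℝ) (hpos : ∀ x x' : Site P j, x ≠ x' → 0 < dist x x')
    (Sg : Site P j → Site P j → W →ₗ[ℝ] W) (φ φ' : SiteField P j W) :
    subtracted319 η Sg φ φ' = holderForm319 η α dist Sg φ φ' := by
  have h2d : η ^ (2 * P.d) = η ^ P.d * η ^ P.d := by rw [two_mul, pow_add]
  -- the counterterm as a double sum with the weight η^{2d}
  have hct : ∑ x : Site P j, η ^ P.d * ⟪φ x, (∑ x' : Site P j, η ^ P.d • Sg x x') (φ' x)⟫ =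
      ∑ x : Site P j, ∑ x' : Site P j, η ^ (2 * P.d) * ⟪φ x, Sg x x' (φ' x)⟫ := by
    refine Finset.sum_congr rfl fun x _ => ?_
    rw [LinearMap.sum_apply, inner_sum, Finset.mul_sum]
    refine Finset.sum_congr rfl fun x' _ => ?_
    rw [LinearMap.smul_apply, real_inner_smul_right, h2d]
    ring
  unfold subtracted319 holderForm319
  rw [hct, ← Finset.sum_sub_distrib]
  refine Finset.sum_congr rfl fun x _ => ?_
  rw [← Finset.sum_sub_distrib]
  refine Finset.sum_congr rfl fun x' _ => ?_
  rw [← mul_sub, ← inner_sub_right, ← map_sub]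
  congr 2
  -- termwise: Σ(φ′(x′) − φ′(x)) = (|x′−x|^α Σ)(|x′−x|^{−α}(φ′(x′) − φ′(x)))
  rw [LinearMap.smul_apply, map_smul, smul_smul]
  by_cases hx : x = x'
  · subst hx
    simp
  · rw [mul_inv_cancel₀ (Real.rpow_pos_of_pos (hpos x x' hx) α).ne', one_smul]

end Eq319

section Chain

/-- The CHAIN ESTIMATE of p. 438 [PDF 28], verbatim: *"For graphs of higher orders usually there is a chain of propagators
connecting a vertex localized in x with a vertex localized in x′, and then we estimate |x′−x|^α ≤ |x′−x₁|^α + … + |x_l−x|^α."*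
— PROVED: for 0 < α ≤ 1, nonnegative segment lengths a_i = |x_i − x_{i−1}| and 0 ≤ t = |x′−x| ≤ Σ_i a_i (the triangle
inequality along the chain, hypothesis `ht`), t^α ≤ Σ_i a_i^α (subadditivity of the concave power).
[cite: Balaban1983Higgs3, (3.19) p.438] -/
theorem rpow_chain_le (α : ℝ) (hα0 : 0 < α) (hα1 : α ≤ 1) {ι : Type*} (s : Finset ι) (a : ι → ℝ)
    (ha : ∀ i ∈ s, 0 ≤ a i) (t : ℝ) (ht0 : 0 ≤ t) (ht : t ≤ ∑ i ∈ s, a i) :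
    t ^ α ≤ ∑ i ∈ s, a i ^ α := by
  classical
  have hsub : ∀ (u : Finset ι), (∀ i ∈ u, 0 ≤ a i) → (∑ i ∈ u, a i) ^ α ≤ ∑ i ∈ u, a i ^ α := by
    intro u
    induction u using Finset.induction_on with
    | empty =>
      intro _
      simp [Real.zero_rpow hα0.ne']
    | insert i u hi ih =>
      intro hu
      rw [Finset.sum_insert hi, Finset.sum_insert hi]
      have hai : 0 ≤ a i := hu i (Finset.mem_insert_self i u)
      have hu' : ∀ k ∈ u, 0 ≤ a k := fun k hk => hu k (Finset.mem_insert_of_mem hk)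
      calc (a i + ∑ k ∈ u, a k) ^ α ≤ a i ^ α + (∑ k ∈ u, a k) ^ α :=
            Real.rpow_add_le_add_rpow hai (Finset.sum_nonneg hu') hα0.le hα1
        _ ≤ a i ^ α + ∑ k ∈ u, a k ^ α := by linarith [ih hu']
  exact (Real.rpow_le_rpow ht0 ht hα0.le).trans (hsub s ha)

end Chain

end

end Literature.MathematicalPhysics.QuantumFieldTheory.Balaban1983to89.B3Sect3Subtraction319
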